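/-
Copyright (c) 2026 the pub-hodgecm-mathlib formalisation cell (harness21).  Prover seat hodgecm-mathlib-F0P3a-p04 (g22): line LH4, «DYADIC PAYDOWN» board (LH4-plan (g3)
WORD #23 (1)), brick «DUAL-all» — dual pieces at EVERY non-split place, hypothesis-free; 2026-09-02.
-/
import Literature.NumberTheory.Rogawski1990.UnipotentOrbitalIntegralDualPiecesOfStrataCM     -- ★ p850268 (this seat): `UnitaryGroup.exists_unipotentDualPieces_antidiagOne_of_strataOpen` (‹DUAL› ⟸ (S2))
import Literature.NumberTheory.Rogawski1990.UnitaryThreeUnipotentStrataAllCM                 -- ★ p850263 (A-p12 (g26)): `exists_isOpen_forall_sameStratum_mem_iff_isConj'` ((S2) at every non-split place)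
import HarnessLib

/-!
# DUAL PIECES for the unipotent orbital integrals of `U(Φ₃)(L⁺_v)` at EVERY non-split place — odd, unramified-dyadic and WILD alike ([Rogawski1990] §8.1 p. 113)

Topic `NumberTheory/Rogawski1990`; namespace `Literature.NumberTheory.Rogawski1990`.  THEOREMS ONLY (no definition, no instance, no notation, no named fact, no `sorry`).
Cell `pub/hodgecm-mathlib` (D-0151), crux H413 = `stmt-HodgeConjecture-24833`, line LH4 (closer row `stub_N6ns`); «DYADIC PAYDOWN» board of LH4-plan (g3), organ (D-SH)
«Shalika at `Φ₃`, dyadic places», road ‹DUAL› (WORD #23: «the wild ‹DUAL› road is the strata road»).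

THIS FILE PROVES `UnitaryGroup.exists_unipotentDualPieces_antidiagOne_nonsplit` = ★ p849114 `UnitaryGroup.exists_unipotentDualPieces_antidiagOne_odd` with the hypothesis
`IsUnit (2 : 𝒪[w.1.adicCompletion L]) →` DELETED and nothing else: for the quasi-split form `Φ₃ = antidiag(1,1,1)`, at EVERY non-split place `v` of `L⁺`
(`Subsingleton (PlacesOver L v)`; no condition on the residue characteristic or on the ramification of `w ∣ v`), for every finite set `S` of unipotent classes of
`G = U(Φ₃)(L⁺_v)` and every orbital-measure family `mU` admissible on `S` with the Ranga-Rao clause, there are dual pieces `fd u ∈ C_c^∞(G)` (`u ∈ S`):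
`Φ_{mU}(u, fd u) = 1`, `Φ_{mU}(u, fd u′) = 0` for `u ≠ u′`.  It is the `hdual` binder of LH10-p01 (g3)'s «SHALIKA-ALL» assembly token for token.

PROOF (one line): ★ `UnitaryGroup.exists_unipotentDualPieces_antidiagOne_of_strataOpen` (p850268: Bernstein–Zelevinsky reference pieces from the strata-open property,
no lattice frame, no skew uniformiser) fed with ★ `exists_isOpen_forall_sameStratum_mem_iff_isConj'` (p850263, A-p12 (g26): every unipotent class is cut out by an open
set inside its stratum at every non-split place — the transvection case through the radius-`|4|` norm step ★ p850139 + the square-root lemma ★ p850199 (W-a)).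

HONEST LABEL: count-neutral pay-down (it lets the dyadic leaf's wild Shalika organ close in-house once the assembly lands; [LS₂] at `v ∣ 2` stays print); HC_CM is proved
only modulo the 7 printed citations (2 remaining: hLiu418 = stmt-HodgeConjecture-24832, h413 = stmt-HodgeConjecture-24833) until rung 0 closes.

## References
* [Rogawski1990] J. D. Rogawski, *Automorphic Representations of Unitary Groups in Three Variables*, Ann. of Math. Stud. 123 (1990): §8.1, proof of Prop. 8.1.1 p. 113 (l. 1–6);
  §3.9 Prop. 3.9.1 p. 32.
* [BernsteinZelevinsky1976] I. N. Bernstein, A. V. Zelevinsky, *Representations of the group GL(n, F) where F is a non-archimedean local field*, Russian Math. Surveys 31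
  (1976), §1.5, §6.
* [HarishChandra1999AdmissibleDistributions] Harish-Chandra (DeBacker–Sally), *Admissible Invariant Distributions on Reductive p-adic Groups*, ULS 16 (1999), §3.1 p. 17.
-/

set_option autoImplicit false

noncomputable section

open MeasureTheory Measure NumberField IsDedekindDomain Topology Filter
open Literature.MeasureTheory.Group Literature.NumberTheory.Automorphic Literature.NumberTheory.Automorphic.UnitaryGroup
open Literature.NumberTheory.GaloisRepresentations
open scoped Matrix MatrixGroups ValuativeRel

namespace Literature.NumberTheory.Rogawski1990

set_option maxHeartbeats 400000 in
-- statement-heavy: four instance binders (as ★ p849114)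
/-- **‹DUAL› at EVERY non-split place, hypothesis-free** (= ★ `UnitaryGroup.exists_unipotentDualPieces_antidiagOne_odd` with the hypothesis `2 ∈ 𝒪_w^×` deleted): for
every finite set `S` of unipotent classes of `U(Φ₃)(L⁺_v)` and every orbital-measure family `mU` admissible on `S` with the Ranga-Rao clause there are `fd u ∈ C_c^∞(G)`
with `Φ_{mU}(u, fd u) = 1` and `Φ_{mU}(u, fd u′) = 0` (`u ≠ u′`).  Proof: ★ ‹DUAL›-of-strata + ★ (S2) at every place.
[cite: Rogawski1990, §8.1 p. 113; §3.9 Prop. 3.9.1 p. 32] [cite: BernsteinZelevinsky1976, §1.5, §6] [cite: HarishChandra1999AdmissibleDistributions, §3.1 p. 17] -/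
theorem UnitaryGroup.exists_unipotentDualPieces_antidiagOne_nonsplit :
    ∀ (L : Type) [Field L] [NumberField L] [IsCMField L] (v : HeightOneSpectrum (𝓞 ↥(maximalRealSubfield L))) (w : UnitaryGroup.PlacesOver L v),
      Subsingleton (UnitaryGroup.PlacesOver L v) →
      ∀ [MeasurableSpace ((cmDatum L 3 (Matrix.of fun i j : Fin 3 => if i.val + j.val + 1 = 3 then (1 : L) else 0)).Local v)] [BorelSpace ((cmDatum L 3 (Matrix.of fun i j : Fin 3 => if i.val + j.val + 1 = 3 then (1 : L) else 0)).Local v)]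
        [∀ γ : ((cmDatum L 3 (Matrix.of fun i j : Fin 3 => if i.val + j.val + 1 = 3 then (1 : L) else 0)).Local v), MeasurableSpace (((cmDatum L 3 (Matrix.of fun i j : Fin 3 => if i.val + j.val + 1 = 3 then (1 : L) else 0)).Local v) ⧸ Subgroup.centralizer ({γ} : Set ((cmDatum L 3 (Matrix.of fun i j : Fin 3 => if i.val + j.val + 1 = 3 then (1 : L) else 0)).Local v)))]
        [∀ γ : ((cmDatum L 3 (Matrix.of fun i j : Fin 3 => if i.val + j.val + 1 = 3 then (1 : L) else 0)).Local v), BorelSpace (((cmDatum L 3 (Matrix.of fun i j : Fin 3 => if i.val + j.val + 1 = 3 then (1 : L) else 0)).Local v) ⧸ Subgroup.centralizer ({γ} : Set ((cmDatum L 3 (Matrix.of fun i j : Fin 3 => if i.val + j.val + 1 = 3 then (1 : L) else 0)).Local v)))],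
      ∀ (S : Finset (ConjClasses ((cmDatum L 3 (Matrix.of fun i j : Fin 3 => if i.val + j.val + 1 = 3 then (1 : L) else 0)).Local v))) (mU : OrbitalMeasureFamily ((cmDatum L 3 (Matrix.of fun i j : Fin 3 => if i.val + j.val + 1 = 3 then (1 : L) else 0)).Local v)),
        (∀ u ∈ S, (((Quotient.out u : ((cmDatum L 3 (Matrix.of fun i j : Fin 3 => if i.val + j.val + 1 = 3 then (1 : L) else 0)).Local v)).val : GL (Fin 3) (UnitaryGroup.LocalRing L v)).val - 1) ^ 3 = 0) →
        mU.IsAdmissibleOn (fun γ : ((cmDatum L 3 (Matrix.of fun i j : Fin 3 => if i.val + j.val + 1 = 3 then (1 : L) else 0)).Local v) => (ConjClasses.mk γ) ∈ S) →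
        (∀ u ∈ S, ∀ f : ((cmDatum L 3 (Matrix.of fun i j : Fin 3 => if i.val + j.val + 1 = 3 then (1 : L) else 0)).Local v) → ℂ, IsLocSmooth f →
            Integrable (descConj (Quotient.out u : ((cmDatum L 3 (Matrix.of fun i j : Fin 3 => if i.val + j.val + 1 = 3 then (1 : L) else 0)).Local v)) (Subgroup.centralizer ({(Quotient.out u : ((cmDatum L 3 (Matrix.of fun i j : Fin 3 => if i.val + j.val + 1 = 3 then (1 : L) else 0)).Local v))} : Set ((cmDatum L 3 (Matrix.of fun i j : Fin 3 => if i.val + j.val + 1 = 3 then (1 : L) else 0)).Local v)))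
              (fun _ hg => Subgroup.mem_centralizer_singleton_iff.1 hg) f) (mU u)) →
        ∃ fd : ConjClasses ((cmDatum L 3 (Matrix.of fun i j : Fin 3 => if i.val + j.val + 1 = 3 then (1 : L) else 0)).Local v) → ((cmDatum L 3 (Matrix.of fun i j : Fin 3 => if i.val + j.val + 1 = 3 then (1 : L) else 0)).Local v) → ℂ,
          (∀ u ∈ S, IsLocSmooth (fd u)) ∧ (∀ u ∈ S, classOrbitalIntegral mU (fd u) u = 1) ∧
          (∀ u ∈ S, ∀ u' ∈ S, u ≠ u' → classOrbitalIntegral mU (fd u') u = 0) :=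
  fun L _ _ _ v w hsub => UnitaryGroup.exists_unipotentDualPieces_antidiagOne_of_strataOpen L v w hsub
    (exists_isOpen_forall_sameStratum_mem_iff_isConj' L v w hsub)

end Literature.NumberTheory.Rogawski1990

end
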